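import Mathlib
import Literature.RingTheory.CohomologyAnnihilator.BirationalTransfer
import HarnessLib

/-!
# Trace elements of rank-one-like modules are stable annihilators

Crux `HomologicalConductor.Persistence` (stmt-ResolutionOfSingularities-16484), chain W4.4b,
res-L1-w44b-stub-1 (g2), report `L/res-L1-w44b-stub-1/SIGMA5.md` §0.1/§1 (the identity
`ann̲(M_χ) ⊇ τ(M_χ) = M_χ · M_{-χ}` for the rank-one reflexives of a quotient singularity, used for
the trace-ideal sandwich `τ_all² ⊆ ca ⊆ τ_all`). `[OURS · L1 w44b]` — elementary linear algebra;
NOT a statement of the manuscript under review; AI-drafted (weaker than expert review).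

If an `R`-module `M` has the **rank-one symmetry** `φ x • y = φ y • x` for the linear forms `φ`
involved (true for every submodule of the fraction field of a domain, in particular for divisorial
ideals / modules of semi-invariants), then every element `t = Σ_k φ_k (m_k)` of the span of the
values `φ_k(M)` acts on `M` through the free module `ι → R`: `α m = (φ_k m)_k`, `β c = Σ_k c_k • m_k`,
and `β (α m) = Σ_k φ_k(m) • m_k = Σ_k φ_k(m_k) • m = t • m`. Consequently `t` kills
`Extⁱ_R(M, N)` for all `N` and all `i ≥ 1` (tree lemma `smul_ext_eq_zero_of_linearMap_comp_eq_smul_id`).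
-/

-- single-problem summit: the doubled namespace component is forced
set_option linter.dupNamespace false

noncomputable section

open CategoryTheory CategoryTheory.Abelian

universe u

namespace Summit.ResolutionOfSingularities.ResolutionOfSingularities.Theorems.HomologicalConductor.PersistenceTraceFactor

open Literature.RingTheory.CohomologyAnnihilator

variable {R : Type u} [CommRing R]

/-- **Trace elements factor through a free module (rank-one symmetry).** Let `φ : ι → (M →ₗ R)`
and `m : ι → M` with `ι` finite, and assume `φ k x • y = φ k y • x` for all `k, x, y`. Then
`(Σ_k φ k (m k)) • 1_M = β ∘ α` with `α : M → (ι → R)`, `α x = (φ k x)_k`, and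
`β : (ι → R) → M`, `β c = Σ_k c k • m k`. [folklore] -/
theorem exists_comp_eq_smul_id_of_symm {M : Type*} [AddCommGroup M] [Module R M] {ι : Type*}
    [Fintype ι] [DecidableEq ι] (φ : ι → (M →ₗ[R] R)) (m : ι → M)
    (hsymm : ∀ (k : ι) (x y : M), φ k x • y = φ k y • x) :
    ∃ (α : M →ₗ[R] (ι → R)) (β : (ι → R) →ₗ[R] M),
      β ∘ₗ α = (∑ k, φ k (m k)) • LinearMap.id := by
  refine ⟨LinearMap.pi φ, Fintype.linearCombination R m, LinearMap.ext fun x => ?_⟩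
  rw [LinearMap.comp_apply, LinearMap.smul_apply, LinearMap.id_apply, Finset.sum_smul,
    Fintype.linearCombination_apply]
  refine Finset.sum_congr rfl fun k _ => ?_
  rw [LinearMap.pi_apply]
  exact hsymm k x (m k)

/-- **Trace elements kill positive `Ext` (rank-one symmetry).** In the situation of
`exists_comp_eq_smul_id_of_symm` (with `ι = Fin s`), `t = Σ_k φ k (m k)` kills `Extⁱ_R(M, N)` for
every `R`-module `N` and every `i ≥ 1`. [folklore] -/
theorem smul_ext_eq_zero_of_symm {M : Type u} [AddCommGroup M] [Module R M] {s : ℕ}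
    (φ : Fin s → (M →ₗ[R] R)) (m : Fin s → M)
    (hsymm : ∀ (k : Fin s) (x y : M), φ k x • y = φ k y • x)
    (N : ModuleCat.{u} R) {i : ℕ} (hi : 1 ≤ i) (e : Ext.{u} (ModuleCat.of R M) N i) :
    (∑ k, φ k (m k)) • e = 0 := by
  obtain ⟨α, β, h⟩ := exists_comp_eq_smul_id_of_symm φ m hsymm
  exact smul_ext_eq_zero_of_linearMap_comp_eq_smul_id α β h N hi e

/-- **Rank-one symmetry for submodules of an algebra on which linear forms are multiplications.**
If `M` is an `R`-submodule of a commutative `R`-algebra `K` and every `R`-linear form on `M` is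
the restriction of multiplication by an element of `K` followed by a map landing in `R`
(precisely: `algebraMap R K (φ x) = a * x` for some `a : K` and all `x ∈ M`), then
`φ x • y = φ y • x` on `M` (no injectivity of `algebraMap R K` is needed: the identity is checked
inside `K`). This is the situation of fractional / divisorial
ideals of a domain (`K` = fraction field). [folklore] -/
theorem smul_comm_of_forall_exists_mul {K : Type*} [CommRing K] [Algebra R K]
    (M : Submodule R K) (φ : M →ₗ[R] R)
    (hφ : ∃ a : K, ∀ x : M, algebraMap R K (φ x) = a * (x : K)) (x y : M) :
    φ x • y = φ y • x := by
  obtain ⟨a, ha⟩ := hφ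
  apply Subtype.ext
  have hx := ha x
  have hy := ha y
  -- compare in K: (φ x) • y = φ x * y = a x y = a y x = (φ y) • x
  have key : algebraMap R K (φ x) * (y : K) = algebraMap R K (φ y) * (x : K) := by
    rw [hx, hy]; ring
  have e1 : ((φ x • y : M) : K) = algebraMap R K (φ x) * (y : K) := by
    rw [Submodule.coe_smul, Algebra.smul_def]
  have e2 : ((φ y • x : M) : K) = algebraMap R K (φ y) * (x : K) := by
    rw [Submodule.coe_smul, Algebra.smul_def]
  rw [e1, e2, key]

end Summit.ResolutionOfSingularities.ResolutionOfSingularities.Theorems.HomologicalConductor.PersistenceTraceFactor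

end
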